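import Summits.ResolutionOfSingularities.ResolutionOfSingularities.Theorems.FrobeniusClosingPatchingRelPerfectMonomialSumPairs
import Literature.AlgebraicGeometry.Resolution.MonomialPart
import HarnessLib

/-!
# Crux `PatchingRelPerfect` (stmt-ResolutionOfSingularities-16161), chain w52 — toward TargetsF3 M2 in
# general: ONE BLOW-UP OF A FAMILY OF MONOMIAL IDEALS ALONG ANY SINGULAR STRATUM (fact-free bookkeeping)

[OURS · L1 W5.2 · R-mono support, PARTIAL toward M2 `DepthTargets.MonomialSumPrincipalization`]
M2 for families of `≥ 3` exponent lists — principalization of `monomialSum 𝒦 = Σ_i monomialIdeal (𝒦 i)`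
with centres over the cosupport OF THE SUM — is the combinatorial reduction of singularities of the
Newton polyhedra system of `𝒦` (Molina-Samper, arXiv:1711.08258, Thm. 2 / Cor. 2 with `d = 1`, §5.3;
centres = strata `E_J` in the singular locus), NOT the pairwise theorem (p503306) — see
`…MonomialSumPairs.lean` for the witness.  Whatever combinatorial strategy is formalized, its scheme
side is ONE statement, PROVED here: blowing up the stratum of ANY set `T` of boundary divisors on which
every member of the family has weight `≥ m ≥ 1` (so `V(T) ⊆ V(monomialSum 𝒦)`: a SINGULAR stratum)
and dividing the exceptional divisor out `m` times transforms the family member by member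
(`transformExp · π T m`), keeps the common simple normal crossings boundary, multiplies the total
transform of the sum by `𝓘(F)^m`, and keeps the cosupport of the new sum over the old one:

* `coe_support_monomialSum`, `support_finsetSup_subset_support_monomialSum`,
  `comap_monomialSum_eq_pow_mul` (**`π^*(Σ_i A_i) = 𝓘(F)^m · Σ_i A_i'`**), `exists_singularStratumStep`;
* the tower predicate `AdmitsSingularStratumTower 𝒦` (a `CentreSeq` with regular centres over
  `V(monomialSum 𝒦)`, an snc boundary on top, a locally principal `M` and a transformed family `𝒦'`
  with `π^*(monomialSum 𝒦) = M · monomialSum 𝒦'`), its `nil`/`cons`, and the END criterion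
  `isLocallyPrincipal_comap_of_tower_of_eq_top` (if the final sum is the unit ideal, the total
  transform of the sum is locally principal) — so that M2 is REDUCED to exhibiting a terminating choice
  of singular strata (the polyhedra game), with no further scheme theory.

Any dimension; fact-free; nothing here is a statement of the manuscript under review.

## References

* J. Kollár, *Lectures on Resolution of Singularities* (2007), (3.111) Step 3. [Kollar2007]
* R. Goward, *A simple algorithm for principalization of monomial ideals*, Trans. AMS 357 (2005).
  [Goward2005]
-/

-- `Summit.<Summit>.<Sub>.Theorems` with `Sub = Summit` (single-conjunct summit, D-0017)
set_option linter.dupNamespace false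

noncomputable section

open CategoryTheory AlgebraicGeometry TopologicalSpace IsLocalRing
open Literature.AlgebraicGeometry.Resolution

namespace Summit.ResolutionOfSingularities.ResolutionOfSingularities.Theorems

namespace MonomialCleanup

open DepthTargets (monomialSum monomialSum_nil monomialSum_cons)

universe u

/-! ## The cosupport of a sum of monomial ideals -/

section Support

variable {X : Scheme.{u}}

/-- **`V(Σ_i A_i) = ⋂_i V(A_i)`.** [folklore] -/
theorem coe_support_monomialSum (𝒦 : List (List (X.IdealSheafData × ℕ))) :
    ((monomialSum 𝒦).support : Set X) = ⋂ A ∈ 𝒦, ((monomialIdeal A).support : Set X) := by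
  induction 𝒦 with
  | nil => simp [monomialSum_nil, Scheme.IdealSheafData.support_bot]
  | cons A 𝒦 ih =>
    rw [monomialSum_cons, Scheme.IdealSheafData.support_sup, Closeds.coe_inf, ih]
    ext x
    simp

/-- If every divisor of `T` has exponent zero, the weight of `T` is zero. [folklore] -/
theorem weightOf_eq_zero_of_forall_expOf_eq_zero {A : List (X.IdealSheafData × ℕ)}
    {T : Finset X.IdealSheafData} (h : ∀ L ∈ T, expOf A L = 0) : weightOf A T = 0 := by
  classical
  induction T using Finset.induction_on with
  | empty => simp
  | insert K T hK ih =>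
    rw [weightOf_insert A hK, h K (Finset.mem_insert_self K T),
      ih fun L hL => h L (Finset.mem_insert_of_mem hL)]

/-- A positive weight on `T` is carried by some divisor of `T`. [folklore] -/
theorem exists_expOf_pos_of_weightOf_pos {A : List (X.IdealSheafData × ℕ)} {T : Finset X.IdealSheafData}
    (h : 0 < weightOf A T) : ∃ L ∈ T, 0 < expOf A L := by
  by_contra hne
  push Not at hne
  have h0 := weightOf_eq_zero_of_forall_expOf_eq_zero (A := A) (T := T) fun L hL => Nat.le_zero.mp (hne L hL)
  omega

/-- **A stratum on which every member has positive weight lies in the cosupport of the sum**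
(it is a SINGULAR stratum of the family). [folklore] -/
theorem support_finsetSup_subset_support_monomialSum {𝒦 : List (List (X.IdealSheafData × ℕ))}
    {T : Finset X.IdealSheafData} (hpos : ∀ A ∈ 𝒦, 0 < weightOf A T) :
    ((T.sup id).support : Set X) ⊆ (monomialSum 𝒦).support := by
  intro x hx
  rw [coe_support_monomialSum]
  refine Set.mem_iInter₂.mpr fun A hA => ?_
  obtain ⟨L, hLT, hL⟩ := exists_expOf_pos_of_weightOf_pos (hpos A hA)
  have hLA : L ∈ sheaves A := by
    by_contra h
    rw [expOf_eq_zero_of_not_mem h] at hL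
    exact lt_irrefl 0 hL
  exact mem_support_monomialIdeal hLA (by omega) ((mem_support_finsetSup_iff T x).mp hx L hLT)

end Support

/-! ## The total transform of the sum along a singular stratum -/

section Step

variable {X X' : Scheme.{u}} [IsLocallyNoetherian X] {π : X' ⟶ X} {T : Finset X.IdealSheafData}
  {Es : List X.IdealSheafData} {m : ℕ}

/-- A member's monomial ideal after the blow-up: `𝓘(F)^w · Π (E')^a = 𝓘(F)^m · monomialIdeal
(transformExp A π T m)` for `m ≤ w`. [cite: Kollar2007, (3.111) Step 3] -/
theorem comap_monomialIdeal_eq_pow_mul_transformExp {A : List (X.IdealSheafData × ℕ)}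
    (hE : HasSNC (boundaryOf A)) (hT : ∀ K ∈ T, K ∈ boundaryOf A) (hπ : IsBlowup π (T.sup id))
    (hm : m ≤ weightOf A T) :
    (monomialIdeal A).comap π = (T.sup id).comap π ^ m * monomialIdeal (transformExp A π T m) := by
  rw [comap_monomialIdeal hE hT hπ, transformExp, monomialIdeal_append, monomialIdeal_singleton]
  dsimp only
  rw [mul_comm (monomialIdeal _) (_ ^ _), ← mul_assoc, ← pow_add, Nat.add_sub_cancel' hm]

/-- **`π^*(Σ_i A_i) = 𝓘(F)^m · Σ_i A_i'`** for the blow-up of a stratum on which every member has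
weight `≥ m`. [cite: Kollar2007, (3.111) Step 3] -/
theorem comap_monomialSum_eq_pow_mul (hEs : HasSNC Es) {𝒦 : List (List (X.IdealSheafData × ℕ))}
    (hb : ∀ A ∈ 𝒦, boundaryOf A = Es) (hT : ∀ K ∈ T, K ∈ Es) (hπ : IsBlowup π (T.sup id))
    (hm : ∀ A ∈ 𝒦, m ≤ weightOf A T) :
    (monomialSum 𝒦).comap π =
      (T.sup id).comap π ^ m * monomialSum (𝒦.map fun A => transformExp A π T m) := by
  induction 𝒦 with
  | nil =>
    rw [List.map_nil, monomialSum_nil, monomialSum_nil, Scheme.IdealSheafData.comap_bot, Scheme.IdealSheafData.mul_bot]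
  | cons A 𝒦 ih =>
    have hA : boundaryOf A = Es := hb A (by simp)
    rw [List.map_cons, monomialSum_cons, monomialSum_cons, Scheme.IdealSheafData.comap_sup,
      ih (fun B hB => hb B (List.mem_cons_of_mem _ hB)) (fun B hB => hm B (List.mem_cons_of_mem _ hB)),
      comap_monomialIdeal_eq_pow_mul_transformExp (hA.symm ▸ hEs) (fun K hK => hA.symm ▸ hT K hK) hπ
        (hm A (by simp)),
      ← add_eq_sup, ← add_eq_sup, mul_add]

omit [IsLocallyNoetherian X] in
/-- The new members live on the common boundary `Es.map strict ++ [F]`. [folklore] -/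
theorem boundaryOf_of_mem_map_transformExp {𝒦 : List (List (X.IdealSheafData × ℕ))}
    (hb : ∀ A ∈ 𝒦, boundaryOf A = Es) {A' : List (X'.IdealSheafData × ℕ)}
    (hA' : A' ∈ 𝒦.map fun A => transformExp A π T m) :
    boundaryOf A' = Es.map (strictTransformIdeal π (T.sup id)) ++ [(T.sup id).comap π] := by
  obtain ⟨A, hA, rfl⟩ := List.mem_map.mp hA'
  rw [boundaryOf_transformExp, hb A hA]

/-- **One blow-up of the family along a singular stratum** (the scheme side of every combinatorial
principalization strategy): for a set `T` of boundary divisors on which every member has weight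
`≥ m ≥ 1`, the chosen blow-up of `V(T)` — a regular centre inside `V(monomialSum 𝒦)` — carries the
family to `𝒦' = 𝒦.map (transformExp · π T m)` on the snc boundary `Es.map strict ++ [F]`, with
`π^*(monomialSum 𝒦) = 𝓘(F)^m · monomialSum 𝒦'` and `V(monomialSum 𝒦')` over `V(monomialSum 𝒦)`.
[cite: Kollar2007, (3.111) Step 3] -/
theorem exists_singularStratumStep (hEs : HasSNC Es) (𝒦 : List (List (X.IdealSheafData × ℕ)))
    (hb : ∀ A ∈ 𝒦, boundaryOf A = Es) (hT : ∀ K ∈ T, K ∈ Es) (hm1 : 1 ≤ m)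
    (hm : ∀ A ∈ 𝒦, m ≤ weightOf A T) :
    Scheme.IsRegular (T.sup id).subscheme ∧
    (((T.sup id).support : Set X) ⊆ (monomialSum 𝒦).support) ∧
    HasSNC (Es.map (strictTransformIdeal (blowup.π (T.sup id)) (T.sup id)) ++
      [(T.sup id).comap (blowup.π (T.sup id))]) ∧
    (∀ A' ∈ 𝒦.map fun A => transformExp A (blowup.π (T.sup id)) T m,
      boundaryOf A' = Es.map (strictTransformIdeal (blowup.π (T.sup id)) (T.sup id)) ++
        [(T.sup id).comap (blowup.π (T.sup id))]) ∧
    (monomialSum 𝒦).comap (blowup.π (T.sup id)) =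
      (T.sup id).comap (blowup.π (T.sup id)) ^ m *
        monomialSum (𝒦.map fun A => transformExp A (blowup.π (T.sup id)) T m) ∧
    ((monomialSum (𝒦.map fun A => transformExp A (blowup.π (T.sup id)) T m)).support : Set _) ⊆
      blowup.π (T.sup id) ⁻¹' (monomialSum 𝒦).support := by
  have hπ : IsBlowup (blowup.π (T.sup id)) (T.sup id) := blowup.isBlowup _
  have hcomap := comap_monomialSum_eq_pow_mul hEs hb hT hπ hm
  refine ⟨hEs.isRegular_subscheme_finsetSup T hT,
    support_finsetSup_subset_support_monomialSum fun A hA => lt_of_lt_of_le hm1 (hm A hA), ?_,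
    fun A' hA' => boundaryOf_of_mem_map_transformExp hb hA', hcomap, ?_⟩
  · have h := (hEs.hasSNCWith_finsetSup T hT).hasSNC_transform hπ
    exact h
  · intro x' hx'
    have hle : (monomialSum 𝒦).comap (blowup.π (T.sup id)) ≤
        monomialSum (𝒦.map fun A => transformExp A (blowup.π (T.sup id)) T m) := by
      rw [hcomap]; exact IdealSheafData.mul_le_left _ _
    have h1 := Scheme.IdealSheafData.support_antitone hle hx'
    rw [Scheme.IdealSheafData.support_comap] at h1
    exact h1

end Step

/-! ## Towers of singular-stratum blow-ups -/

section Tower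

variable {X : Scheme.{u}}

/-- [OURS · L1 W5.2] **A singular-stratum tower for the family `𝒦`**: a `CentreSeq` with regular centres
over `V(monomialSum 𝒦)`, a simple normal crossings boundary `Es'` on its top carrying a transformed
family `𝒦'`, and a locally principal `M` (the exceptional monomial) with
`π^*(monomialSum 𝒦) = M · monomialSum 𝒦'`. [folklore] -/
def AdmitsSingularStratumTower (𝒦 : List (List (X.IdealSheafData × ℕ))) : Prop :=
  ∃ (s : CentreSeq X) (Es' : List s.top.IdealSheafData) (𝒦' : List (List (s.top.IdealSheafData × ℕ)))
    (M : s.top.IdealSheafData),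
    s.AllRegular ∧ s.CentresOver ((monomialSum 𝒦).support : Set X) ∧ HasSNC Es' ∧
    (∀ A' ∈ 𝒦', boundaryOf A' = Es') ∧ IsLocallyPrincipal M ∧
    (monomialSum 𝒦).comap s.comp = M * monomialSum 𝒦' ∧
    𝒦'.length = 𝒦.length

/-- The empty tower. [folklore] -/
theorem AdmitsSingularStratumTower.nil {Es : List X.IdealSheafData} (hEs : HasSNC Es)
    {𝒦 : List (List (X.IdealSheafData × ℕ))} (hb : ∀ A ∈ 𝒦, boundaryOf A = Es) :
    AdmitsSingularStratumTower 𝒦 := by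
  have h : (monomialSum 𝒦).comap (𝟙 X) = ⊤ * monomialSum 𝒦 := by
    rw [Scheme.IdealSheafData.comap_id, Scheme.IdealSheafData.top_mul]
  exact ⟨CentreSeq.nil X, Es, 𝒦, ⊤, trivial, trivial, hEs, hb, isLocallyPrincipal_top X, h, rfl⟩

/-- Prepending one singular-stratum blow-up to a tower on the blow-up. [folklore] -/
theorem AdmitsSingularStratumTower.cons [IsLocallyNoetherian X] {𝒦 : List (List (X.IdealSheafData × ℕ))}
    (C : X.IdealSheafData) {𝒦₁ : List (List ((blowup C).IdealSheafData × ℕ))} {m : ℕ}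
    (hC : Scheme.IsRegular C.subscheme) (hCsupp : (C.support : Set X) ⊆ (monomialSum 𝒦).support)
    (hcomap : (monomialSum 𝒦).comap (blowup.π C) = C.comap (blowup.π C) ^ m * monomialSum 𝒦₁)
    (hsupp : ((monomialSum 𝒦₁).support : Set _) ⊆ blowup.π C ⁻¹' (monomialSum 𝒦).support)
    (hlen : 𝒦₁.length = 𝒦.length) (h : AdmitsSingularStratumTower 𝒦₁) :
    AdmitsSingularStratumTower 𝒦 := by
  obtain ⟨s, Es', 𝒦', M, hreg, hover, hsnc, hb', hM, hfmt, hlen'⟩ := h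
  have hF : IsLocallyPrincipal (C.comap (blowup.π C)) :=
    (blowup.isBlowup C).isEffectiveCartier.isLocallyPrincipal
  refine ⟨CentreSeq.cons C s, Es', 𝒦', (C.comap (blowup.π C)).comap s.comp ^ m * M,
    (CentreSeq.allRegular_cons C s).mpr ⟨hC, hreg⟩,
    (CentreSeq.centresOver_cons C s _).mpr ⟨hCsupp, CentreSeq.CentresOver.mono s hsupp hover⟩,
    hsnc, hb', ((hF.comap s.comp).pow m).mul hM, ?_, hlen'.trans hlen⟩
  have hk : (monomialSum 𝒦).comap (s.comp ≫ blowup.π C) =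
      (C.comap (blowup.π C)).comap s.comp ^ m * M * monomialSum 𝒦' := by
    rw [Scheme.IdealSheafData.comap_comp, hcomap, comap_mul, comap_pow, hfmt, mul_assoc]
  exact hk

/-- **END criterion**: a tower whose final family generates the unit ideal principalizes the total
transform of the sum (which is then the locally principal exceptional monomial `M`). [folklore] -/
theorem isLocallyPrincipal_comap_of_eq_top {𝒦 : List (List (X.IdealSheafData × ℕ))} {s : CentreSeq X}
    {𝒦' : List (List (s.top.IdealSheafData × ℕ))} {M : s.top.IdealSheafData} (hM : IsLocallyPrincipal M)
    (hfmt : (monomialSum 𝒦).comap s.comp = M * monomialSum 𝒦') (htop : monomialSum 𝒦' = ⊤) :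
    IsLocallyPrincipal ((monomialSum 𝒦).comap s.comp) := by
  rw [hfmt, htop, Scheme.IdealSheafData.mul_top]
  exact hM

/-- Weight zero at `x`: no divisor through `x` has positive exponent, so the stalk of the monomial
ideal is the unit ideal. [folklore] -/
theorem prod_stalkIdeal_pow_eq_top_of_weightAt_eq_zero (A : List (X.IdealSheafData × ℕ)) (x : X)
    (h : weightAt A x = 0) : (A.map fun p => stalkIdeal p.1 x ^ p.2).prod = ⊤ := by
  induction A with
  | nil => simp
  | cons p A ih =>
    rw [weightAt_cons] at h
    rw [List.map_cons, List.prod_cons]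
    by_cases hxp : x ∈ p.1.support
    · rw [if_pos hxp] at h
      have hp2 : p.2 = 0 := by omega
      rw [hp2, pow_zero, one_mul]
      exact ih (by omega)
    · rw [if_neg hxp] at h
      rw [stalkIdeal_eq_top_of_not_mem_support hxp, Ideal.top_pow, Ideal.top_mul]
      exact ih (by simpa using h)

/-- **The unit-ideal criterion for a sum of monomial ideals**: if at every point some member has
weight zero (no divisor through the point carries it), the sum is the unit ideal sheaf. [folklore] -/
theorem monomialSum_eq_top_of_forall_exists_weightAt_eq_zero {𝒦 : List (List (X.IdealSheafData × ℕ))}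
    (h : ∀ x : X, ∃ A ∈ 𝒦, weightAt A x = 0) : monomialSum 𝒦 = ⊤ := by
  rw [← Scheme.IdealSheafData.support_eq_bot_iff, ← le_bot_iff]
  intro x hx
  obtain ⟨A, hA, hA0⟩ := h x
  have hx' : x ∈ ((monomialSum 𝒦).support : Set X) := hx
  rw [coe_support_monomialSum] at hx'
  have hxA : x ∈ (monomialIdeal A).support := Set.mem_iInter₂.mp hx' A hA
  rw [mem_support_iff_stalkIdeal_le, stalkIdeal_monomialIdeal,
    prod_stalkIdeal_pow_eq_top_of_weightAt_eq_zero A x hA0, top_le_iff] at hxA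
  exact absurd hxA (maximalIdeal.isMaximal _).ne_top

end Tower

end MonomialCleanup

end Summit.ResolutionOfSingularities.ResolutionOfSingularities.Theorems

end
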